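import Summits.QuantumFields.QCD.Theses.SpectralDefectExtinction
import Summits.QuantumFields.QCD.Theorems.SpectralDefectExtinctionTipNoBinding

/-!
# Route SpectralDefectExtinction — `ExtinctionOfPricing` (item stmt-QuantumFields-14762)

Support item of route `route-QuantumFields-SpectralDefectExtinction` (sub-problem `QCD` of the
summit `QuantumFields`): the glue edge `TipPricing → WegnerEstimate → WindowExtinction`.

`TipPricing` is by definition the implication `TipNoBinding → WegnerEstimate → WindowExtinction`,
and the tip lemma `TipNoBinding` is a theorem of the tree
(`Summit.QuantumFields.QCD.Cruxes.TipNoBinding.PositivityNoLeakSpread.TipNoBinding_of`,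
file `Theorems/SpectralDefectExtinctionTipNoBinding.lean`), so the pricing step and the Wegner
estimate alone already give spectral-defect extinction.  Pure logic on top of that theorem; no
named-fact hypotheses; axioms ⊆ {propext, Classical.choice, Quot.sound}.
-/

namespace Summit.QuantumFields.QCD.Theorems

/-- **`ExtinctionOfPricing`** (item stmt-QuantumFields-14762):
`TipPricing → WegnerEstimate → WindowExtinction`.
Proof: `TipPricing` unfolds to `TipNoBinding → WegnerEstimate → WindowExtinction`; feed it the
landed tip lemma `TipNoBinding_of` and the Wegner hypothesis. -/
theorem extinctionOfPricing_proof :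
    Summit.QuantumFields.QCD.Theses.SpectralDefectExtinction.ExtinctionOfPricing := by
  unfold Summit.QuantumFields.QCD.Theses.SpectralDefectExtinction.ExtinctionOfPricing
  intro hP hG
  exact hP Summit.QuantumFields.QCD.Cruxes.TipNoBinding.PositivityNoLeakSpread.TipNoBinding_of hG

end Summit.QuantumFields.QCD.Theorems
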